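import Mathlib
import HarnessLib
import Summits.AtomisticToContinuum.FouriersLaw.Theses.BondHeatUncertainty
import Literature.MathematicalPhysics.KineticTheory.LangevinChainKernel
import Literature.MathematicalPhysics.KineticTheory.LangevinChainGibbs

/-!
# Sketch — crux-ideate stmt-AtomisticToContinuum-9121 (ExtensiveSnapshotIrreversibility), ideator 2

First lemmas of the two idea cards `flip-rate-groenwall` and `window-jensen-bond-heat`, stated over
existing declarations only (pinnedChain, bondCurrent, generator, transitionKernel, gibbsMeasure).
Nothing here is proved; the point is that the statements elaborate.
-/

namespace Summit.AtomisticToContinuum.FouriersLaw.Cruxes.ExtensiveSnapshotIrreversibility.Ideator2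

open scoped BigOperators Topology
open Filter Set MeasureTheory
open Literature.MathematicalPhysics.KineticTheory.HeatConduction

/-- The energy of the part of the chain to the RIGHT of bond `(b, b+1)`, with half of that bond's
potential energy attributed to the right: `R_b = Σ_{k > b} (p_k²/2 + U q_k) + Σ_{i > b} V(q_{i+1} - q_i) + ½ V(q_{b+1} - q_b)`. -/
noncomputable def rightEnergy (P : OscillatorChain) (N b : ℕ) (x : PhaseSpace N) : ℝ :=
  (∑ k : Fin N, if b < k.val then (x.2 k ^ 2 / 2 + P.U (x.1 k)) else 0) +
    (∑ i : Fin N, ∑ j : Fin N, if j.val = i.val + 1 ∧ b < i.val then P.V (x.1 j - x.1 i) else 0) +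
    (∑ i : Fin N, ∑ j : Fin N, if j.val = i.val + 1 ∧ i.val = b then P.V (x.1 j - x.1 i) / 2 else 0)

/-- (I2) MICROSCOPIC CONTINUITY ACROSS ONE CUT (fixed `N`, algebraic; style of the PROVED
`generator_hamiltonian`): the generator applied to the right-part energy is the symmetrised bond
current INTO the right part plus the right-bath exchange term,
`L R_b = j_b + γ (T_R - p_{N-1}²)` for `b + 1 < N`. Consequence used by both cards: the odd part of the
single-bond Kubo corrector `u_b = ∫₀^∞ P_s j_b ds` does not depend on `b` and carries the snapshot
irreversibility, `K_N = 2‖P_odd u_b‖²/T⁴`. -/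
theorem generator_rightEnergy (ω₂ lam β γ : ℝ) (N b : ℕ) (hb : b + 1 < N) (T_L T_R : ℝ)
    (x : PhaseSpace N) :
    (pinnedChain ω₂ lam β γ).generator N T_L T_R (rightEnergy (pinnedChain ω₂ lam β γ) N b) x =
      (pinnedChain ω₂ lam β γ).bondCurrent N ⟨b, by omega⟩ x +
        γ * (T_R - x.2 ⟨N - 1, by omega⟩ ^ 2) := by
  sorry

/-- Card `window-jensen-bond-heat`, FIRST LEMMA (fixed `N`; conditional-expectation contraction).
With `W_t(z) = ∫₀ᵗ (P_s j_b)(z) ds = E_z[heat through bond b during [0,t]]`, Θ-reversibility of the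
equilibrium open chain and oddness of `j_b` give `W_t(z) - W_t(Θz) = E[Q_b(-t,t) | x₀ = z]`, hence by
Jensen `∫ (W_t - W_t∘Θ)² dμ_T ≤ Var_eq(Q_b over a window of length 2t) = V_N(b,2t)`. -/
def WindowJensen : Prop :=
  ∀ ω₂ lam β γ : ℝ, 0 < ω₂ → 0 < lam → 0 < β → 0 < γ → ∀ T : ℝ, 0 < T →
    ∀ (N b : ℕ), b + 1 < N → ∀ t : ℝ, 0 ≤ t →
      (let P := pinnedChain ω₂ lam β γ
       let jb : PhaseSpace N → ℝ := fun z => if h : b < N then P.bondCurrent N ⟨b, h⟩ z else 0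
       let Ps : ℝ → (PhaseSpace N → ℝ) → PhaseSpace N → ℝ :=
         fun s f z => ∫ y, f y ∂(P.transitionKernel N T T s.toNNReal z)
       let C : ℝ → ℝ := fun s => ∫ z, jb z * Ps s jb z ∂(P.gibbsMeasure N T)
       let V : ℝ → ℝ := fun τ => 2 * ∫ s in (0 : ℝ)..τ, (τ - s) * C s
       let W : PhaseSpace N → ℝ := fun z => ∫ s in (0 : ℝ)..t, Ps s jb z
       ∫ z, (W z - W (z.1, -z.2)) ^ 2 ∂(P.gibbsMeasure N T) ≤ V (2 * t))

/-- Card `window-jensen-bond-heat`, RESIDUAL / transfer target (N-uniform): the odd part of the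
heat still expected to cross a bulk bond AFTER the Thouless time `c N²` is `O(√N)` in `L²(Gibbs)`:
`‖P_odd ∫_{cN²}^τ P_s j_b ds‖² ≤ C N` eventually in `τ`. With `WindowJensen`, the route's crux (S)
at time `2cN²` and the fixed-`N` identification `K_N = 2‖P_odd u_b‖²/T⁴` this gives (K). -/
def OddForecastTail : Prop :=
  ∀ ω₂ lam β γ : ℝ, 0 < ω₂ → 0 < lam → 0 < β → 0 < γ → ∀ T : ℝ, 0 < T →
    ∃ C c : ℝ, 0 < c ∧ ∀ (N b : ℕ), b + 1 < N →
      ∀ᶠ τ in atTop,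
        (let P := pinnedChain ω₂ lam β γ
         let jb : PhaseSpace N → ℝ := fun z => if h : b < N then P.bondCurrent N ⟨b, h⟩ z else 0
         let Ps : ℝ → (PhaseSpace N → ℝ) → PhaseSpace N → ℝ :=
           fun s f z => ∫ y, f y ∂(P.transitionKernel N T T s.toNNReal z)
         let Wtail : PhaseSpace N → ℝ := fun z => ∫ s in (c * (N : ℝ) ^ 2)..τ, Ps s jb z
         ∫ z, (Wtail z - Wtail (z.1, -z.2)) ^ 2 ∂(P.gibbsMeasure N T) ≤ C * (N : ℝ))

/-- Card `flip-rate-groenwall`, FIRST LEMMA = the `s = 0` member of its transfer target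
(OddGreenKuboBallistic): the truncated Green–Kubo integral of ANY momentum-odd square-integrable
observable of the equilibrium open chain is at most ballistic, `∫₀^τ ⟨φ, P_s φ⟩_{μ_T} ds ≤ C·N·‖φ‖²`
for all `τ`, uniformly in `N` (threshold = transit time; the harmonic member saturates it with
`φ = J_tot`, and it is the quadratic-form input of the Grönwall step in the flip rate). -/
def OddGreenKuboBallistic : Prop :=
  ∀ ω₂ lam β γ : ℝ, 0 < ω₂ → 0 < lam → 0 < β → 0 < γ → ∀ T : ℝ, 0 < T →
    ∃ C : ℝ, ∀ (N : ℕ) (φ : PhaseSpace N → ℝ),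
      (∀ z : PhaseSpace N, φ (z.1, -z.2) = -φ z) →
      MemLp φ 2 ((pinnedChain ω₂ lam β γ).gibbsMeasure N T) →
      ∀ τ : ℝ, 0 < τ →
        ∫ s in (0 : ℝ)..τ,
            ∫ z, φ z * (∫ y, φ y ∂((pinnedChain ω₂ lam β γ).transitionKernel N T T s.toNNReal z))
              ∂((pinnedChain ω₂ lam β γ).gibbsMeasure N T)
          ≤ C * (N : ℝ) * ∫ z, φ z ^ 2 ∂((pinnedChain ω₂ lam β γ).gibbsMeasure N T)

/-- Sanity: the crux decl is in scope under its route name. -/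
example : Prop := Summit.AtomisticToContinuum.FouriersLaw.Theses.BondHeatUncertainty.ExtensiveSnapshotIrreversibility

end Summit.AtomisticToContinuum.FouriersLaw.Cruxes.ExtensiveSnapshotIrreversibility.Ideator2
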